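import Summits.AtomisticToContinuum.BoseEinsteinCondensation.Theses.BECPeriodicReduction
import Summits.AtomisticToContinuum.BoseEinsteinCondensation.Theses.BECInsertionCorrector
import Summits.AtomisticToContinuum.BoseEinsteinCondensation.Theses.BECGroundStateSOS
import Literature.MathematicalPhysics.QuantumManyBody.BogoliubovSpectrumGP
import Summits.AtomisticToContinuum.BoseEinsteinCondensation.Theorems.BECGroundStateSOSRimSqueezeDefs
import Summits.AtomisticToContinuum.BoseEinsteinCondensation.Theorems.BECGroundStateSOSBoundaryTransferWeakTorusCoreFloor
import Summits.AtomisticToContinuum.BoseEinsteinCondensation.Theorems.BECGroundStateSOSBoundaryTransferWeakDirichletEndpoint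

/-!
# Crux `BoundaryTransferWeak` (stmt-AtomisticToContinuum-0827), line `rim-squeeze-monotone-coherence`:
# the ENDPOINT REDUCTION of skeleton v3 (lead a1)

Kernel-checked bookkeeping fact about the registered skeleton v3 of the line
(`Cruxes/BoundaryTransferWeak/Lines/rim_squeeze_monotone_coherence.lean`, lead c3, commit cf623baf9cf4;
stubs (G) torus Ky Fan gap, (T) torus core floor, (M) rim monotonicity, (L) hard-wall limit, (D) Dirichlet
endpoint; composition `RimSqueeze.Line.boundaryTransfer_of_stubs`).

FINDING. The coupling path `t ↦ H^per + t·Σ_j 1_rim(x_j)` enters the composition ONLY through the fixed-`N`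
continuity stub (L) at `t = ⊤`: the two thermodynamic stubs (M) and (L) are consumed exactly once each, at
`(ε, t) = (c/512, t₀(N))`, and what is consumed is their CONSEQUENCE

  (E) `∀ ε > 0, ∀ᶠ N, coreOcc v 0 N ρ' ≤ coreOcc v ⊤ N ρ' + εN`

— the **endpoint transfer**: the core-cube flat-mode occupation floor of the torus ground state at density
`ρ'` survives in the Dirichlet ground state of the cube `[0, L'/2)³` with the same `N` (density `8ρ'`), up to
`εN`. We prove (i) `endpoint_of_rimMonotone_hardWallLimit`: (M) ∧ (L) ⟹ (E) (per potential and density, and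
in the registered `∀ v ∃ ρ₁` shape, `stub_endpointTransfer_of_stubs`); (ii) `boundaryTransfer_of_endpoint`:
(G) ∧ (T) ∧ (E) ∧ (D) ⟹ the crux, concluding `Theses.BECPeriodicReduction.BoundaryTransferWeak` (the item's
registered decl) and the `BECInsertionCorrector` / `BECGroundStateSOS` copies BY NAME; (iii)
`boundaryTransfer_of_stubs_v3`: the v3 composition factors through (ii) ∘ (i). No intermediate coupling
`0 < t < ⊤` carries information into the conclusion.

READING (for the planner / the line's census; prose, not a theorem). (E) is a periodic → Dirichlet transfer of
a FLAT-MODE occupation floor (core mode `χ_C`, `C = (L'/8, 3L'/8)³`) at fixed `N` across an 8-fold compression: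
the same logical type as the crux (an `A`-type floor in, a `B`-type floor out) with the mode pinned — the shape
`Disproof.lean` §5c shows is never easier than the mode-free crux, and the shape line `Sketch`
(coupled-bath-relocation: inner-cube flatness transfer at the same `N`) died on (`Lines/Sketch_dead.md`:
R'(v ≠ 0) = bulk local indistinguishability, stmt-12177/12178). The ramp was to supply a LEVER for (E) — a sign
of `∂_t coreOcc` (cross-susceptibility `χ_{O_C,W} ≤ 0`) uniform in `N` and `t`; no such sign theorem exists for
interacting bosons, and the one general path inequality, joint concavity of
`E(t,s) = inf spec (H^per + tW − sO_C)` in `(t,s)` (`E_ts² ≤ E_tt E_ss`), integrates to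
`|coreOcc(T) − coreOcc(0)| ≤ √(⟨W⟩₀ − ⟨W⟩_T) · √(∫₀ᵀ χ_{O_C O_C}) ≤ √N · √(T · sup χ_{O_C O_C})` with the one-mode
susceptibility `χ_{O_C O_C} ≍ N L'²` (a field `s|χ_C⟩⟨χ_C|` moves `O(N)` particles at kinetic price `O(L'⁻²)`),
i.e. it controls only `T ≲ ε²/L'²`, not the `t ≳ 8πa·8ρ'` needed to empty the rim — useless already at `v = 0`.
So the line is, in substance, (E); this file makes that reduction checkable.

All theorems here are sorry-free and take the stub statements as hypotheses (nothing is assumed as an axiom).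
-/

noncomputable section

namespace Summit.AtomisticToContinuum.BoseEinsteinCondensation.RimSqueeze.Endpoint

open Literature.MathematicalPhysics.QuantumManyBody.BoseGas
open MeasureTheory Filter Set
open scoped ENNReal NNReal

/-! ## (i) The path is idle: (M) ∧ (L) ⟹ (E) -/

/-- `εN/2 + εN/2 = εN` in `ℝ≥0∞`. [folklore] -/
theorem ofReal_half_add_half (ε : ℝ) (hε : 0 ≤ ε) (N : ℕ) :
    ENNReal.ofReal (ε / 2 * N) + ENNReal.ofReal (ε / 2 * N) = ENNReal.ofReal (ε * N) := by
  rw [← ENNReal.ofReal_add (by positivity) (by positivity)]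
  congr 1
  ring

/-- **(M) ∧ (L) ⟹ (E), per potential and density.** If along the rim ramp the core occupation never drops
below its `t = 0` value by more than `εN` (rim monotonicity, for every `ε`, eventually in `N`, all finite
`t`), and at fixed `N` the finite-`t` core occupations are eventually below the hard-wall value up to any
`η > 0` (hard-wall limit), then the torus core floor transfers to the Dirichlet endpoint up to `εN`:
`coreOcc(0) ≤ coreOcc(⊤) + εN` eventually in `N`. The coupling path is used at the single value
`t = t₀(N, εN/2)`. [folklore] -/
theorem endpoint_of_rimMonotone_hardWallLimit {v : ℝ → ℝ≥0∞} {ρ' : ℝ}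
    (hM : ∀ ε : ℝ, 0 < ε → ∀ᶠ N : ℕ in atTop, ∀ t : ℝ≥0,
      coreOcc v 0 N ρ' ≤ coreOcc v (t : ℝ≥0∞) N ρ' + ENNReal.ofReal (ε * N))
    (hL : ∀ᶠ N : ℕ in atTop, ∀ η : ℝ, 0 < η → ∃ t₀ : ℝ≥0, ∀ t : ℝ≥0, t₀ ≤ t →
      coreOcc v (t : ℝ≥0∞) N ρ' ≤ coreOcc v ⊤ N ρ' + ENNReal.ofReal η) :
    ∀ ε : ℝ, 0 < ε → ∀ᶠ N : ℕ in atTop,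
      coreOcc v 0 N ρ' ≤ coreOcc v ⊤ N ρ' + ENNReal.ofReal (ε * N) := by
  intro ε hε
  have hε2 : 0 < ε / 2 := by positivity
  filter_upwards [hM (ε / 2) hε2, hL, eventually_gt_atTop 0] with N h1 h2 hN
  have hNr : (0 : ℝ) < N := Nat.cast_pos.2 hN
  have hη : 0 < ε / 2 * N := by positivity
  obtain ⟨t₀, ht₀⟩ := h2 (ε / 2 * N) hη
  calc coreOcc v 0 N ρ' ≤ coreOcc v ((t₀ : ℝ≥0) : ℝ≥0∞) N ρ' + ENNReal.ofReal (ε / 2 * N) := h1 t₀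
    _ ≤ coreOcc v ⊤ N ρ' + ENNReal.ofReal (ε / 2 * N) + ENNReal.ofReal (ε / 2 * N) :=
        add_le_add (ht₀ t₀ le_rfl) le_rfl
    _ = coreOcc v ⊤ N ρ' + ENNReal.ofReal (ε * N) := by
        rw [add_assoc, ofReal_half_add_half ε hε.le N]

/-- **(M) ∧ (L) ⟹ (E) in the registered `∀ v ∃ ρ₁` shape** (threshold `min ρ_M ρ_L`): the endpoint-transfer
statement (E) is a formal consequence of the two registered stubs `stub_rimMonotone` and
`stub_hardWallLimit` of skeleton v3, verbatim their signatures. [folklore] -/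
theorem stub_endpointTransfer_of_stubs
    (hM : ∀ v : ℝ → ℝ≥0∞, IsRepulsiveFiniteRange v → ∃ ρ₁ : ℝ, 0 < ρ₁ ∧ ∀ ρ' : ℝ, 0 < ρ' → ρ' < ρ₁ →
      ∀ ε : ℝ, 0 < ε → ∀ᶠ N : ℕ in atTop, ∀ t : ℝ≥0,
        coreOcc v 0 N ρ' ≤ coreOcc v (t : ℝ≥0∞) N ρ' + ENNReal.ofReal (ε * N))
    (hL : ∀ v : ℝ → ℝ≥0∞, IsRepulsiveFiniteRange v → ∃ ρ₁ : ℝ, 0 < ρ₁ ∧ ∀ ρ' : ℝ, 0 < ρ' → ρ' < ρ₁ →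
      ∀ᶠ N : ℕ in atTop, ∀ η : ℝ, 0 < η → ∃ t₀ : ℝ≥0, ∀ t : ℝ≥0, t₀ ≤ t →
        coreOcc v (t : ℝ≥0∞) N ρ' ≤ coreOcc v ⊤ N ρ' + ENNReal.ofReal η) :
    ∀ v : ℝ → ℝ≥0∞, IsRepulsiveFiniteRange v → ∃ ρ₁ : ℝ, 0 < ρ₁ ∧ ∀ ρ' : ℝ, 0 < ρ' → ρ' < ρ₁ →
      ∀ ε : ℝ, 0 < ε → ∀ᶠ N : ℕ in atTop,
        coreOcc v 0 N ρ' ≤ coreOcc v ⊤ N ρ' + ENNReal.ofReal (ε * N) := by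
  intro v hv
  obtain ⟨ρM, hρM, hM'⟩ := hM v hv
  obtain ⟨ρL, hρL, hL'⟩ := hL v hv
  refine ⟨min ρM ρL, lt_min hρM hρL, fun ρ' hρ' hlt => ?_⟩
  exact endpoint_of_rimMonotone_hardWallLimit (hM' ρ' hρ' (hlt.trans_le (min_le_left _ _)))
    (hL' ρ' hρ' (hlt.trans_le (min_le_right _ _)))

/-! ## (ii) The endpoint composition: (G) ∧ (T) ∧ (E) ∧ (D) ⟹ the crux -/

/-- Real-number bookkeeping: `c/128 = c/256 + c/256`. [folklore] -/
theorem ofReal_split_two (c : ℝ) (hc : 0 < c) (N : ℕ) :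
    ENNReal.ofReal (c / 128 * N) = ENNReal.ofReal (c / 256 * N) + ENNReal.ofReal (c / 256 * N) := by
  rw [← ENNReal.ofReal_add (by positivity) (by positivity)]
  congr 1
  ring

/-- **The per-potential transfer from (G), (T), (E), (D)** (no coupling path). For `ρ < 8·min(ρ_A, ρ_G, ρ_E)`
run at `ρ' = ρ/8`: `A` + (G) + (T) give the torus core floor `(c/128)N`; (E) at `ε = c/256` carries it to
the Dirichlet endpoint, `(c/256)N ≤ coreOcc(⊤)`; (D) concludes `HasGroundStateBEC v (8·ρ/8)`. [folklore] -/
theorem boundaryTransfer_of_endpoint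
    (hG : ∀ v : ℝ → ℝ≥0∞, IsRepulsiveFiniteRange v → ∃ ρ₁ : ℝ, 0 < ρ₁ ∧ ∀ ρ' : ℝ, 0 < ρ' → ρ' < ρ₁ →
      ∀ᶠ N : ℕ in atTop,
        2 * periodicGroundStateEnergy v N (sideLength ρ' N) < kyFanTwo v N (sideLength ρ' N))
    (hT : ∀ v : ℝ → ℝ≥0∞, IsRepulsiveFiniteRange v → ∀ ρ' : ℝ, 0 < ρ' → ∀ c : ℝ, 0 < c → ∀ N : ℕ,
      2 * periodicGroundStateEnergy v N (sideLength ρ' N) < kyFanTwo v N (sideLength ρ' N) →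
      (∃ δ : ℝ≥0∞, 0 < δ ∧ ∀ Ψ : PeriodicTrialState N (sideLength ρ' N),
          periodicEnergy v Ψ ≤ periodicGroundStateEnergy v N (sideLength ρ' N) + δ →
            ENNReal.ofReal (c * N) ≤ condensateOccupation N (sideLength ρ' N) Ψ.ψ) →
      ENNReal.ofReal (c / 128 * N) ≤ coreOcc v 0 N ρ')
    (hE : ∀ v : ℝ → ℝ≥0∞, IsRepulsiveFiniteRange v → ∃ ρ₁ : ℝ, 0 < ρ₁ ∧ ∀ ρ' : ℝ, 0 < ρ' → ρ' < ρ₁ →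
      ∀ ε : ℝ, 0 < ε → ∀ᶠ N : ℕ in atTop,
        coreOcc v 0 N ρ' ≤ coreOcc v ⊤ N ρ' + ENNReal.ofReal (ε * N))
    (hD : ∀ v : ℝ → ℝ≥0∞, IsRepulsiveFiniteRange v → ∀ ρ' : ℝ, 0 < ρ' →
      (∃ c : ℝ, 0 < c ∧ ∀ᶠ N : ℕ in atTop, ENNReal.ofReal (c * N) ≤ coreOcc v ⊤ N ρ') →
        HasGroundStateBEC v (8 * ρ')) :
    ∀ v : ℝ → ℝ≥0∞, IsRepulsiveFiniteRange v →
      (∃ ρ₀ : ℝ, 0 < ρ₀ ∧ ∀ ρ : ℝ, 0 < ρ → ρ < ρ₀ → ∃ c : ℝ, 0 < c ∧ ∀ᶠ N : ℕ in atTop,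
        ∃ δ : ℝ≥0∞, 0 < δ ∧ ∀ Ψ : PeriodicTrialState N (sideLength ρ N),
          periodicEnergy v Ψ ≤ periodicGroundStateEnergy v N (sideLength ρ N) + δ →
            ENNReal.ofReal (c * N) ≤ condensateOccupation N (sideLength ρ N) Ψ.ψ) →
      ∃ ρ₀ : ℝ, 0 < ρ₀ ∧ ∀ ρ : ℝ, 0 < ρ → ρ < ρ₀ → HasGroundStateBEC v ρ := by
  intro v hv hA
  obtain ⟨ρA, hρA, hA'⟩ := hA
  obtain ⟨ρG, hρG, hG'⟩ := hG v hv
  obtain ⟨ρE, hρE, hE'⟩ := hE v hv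
  set ρs : ℝ := min ρA (min ρG ρE) with hρs_def
  have hρs : 0 < ρs := lt_min hρA (lt_min hρG hρE)
  have hsA : ρs ≤ ρA := min_le_left _ _
  have hsG : ρs ≤ ρG := (min_le_right _ _).trans (min_le_left _ _)
  have hsE : ρs ≤ ρE := (min_le_right _ _).trans (min_le_right _ _)
  refine ⟨8 * ρs, by positivity, fun ρ hρ hρlt => ?_⟩
  have hρ' : 0 < ρ / 8 := by positivity
  have hρ's : ρ / 8 < ρs := by linarith
  obtain ⟨c, hc, hcrit⟩ := hA' (ρ / 8) hρ' (hρ's.trans_le hsA)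
  have hgap := hG' (ρ / 8) hρ' (hρ's.trans_le hsG)
  -- (T): the torus core floor at `t = 0`
  have hfloor : ∀ᶠ N : ℕ in atTop, ENNReal.ofReal (c / 128 * N) ≤ coreOcc v 0 N (ρ / 8) :=
    (hgap.and hcrit).mono fun N hN => hT v hv (ρ / 8) hρ' c hc N hN.1 hN.2
  -- (E): the endpoint transfer at `ε = c/256`
  have hε : 0 < c / 256 := by positivity
  have hend := hE' (ρ / 8) hρ' (hρ's.trans_le hsE) (c / 256) hε
  have key : ∀ᶠ N : ℕ in atTop, ENNReal.ofReal (c / 256 * N) ≤ coreOcc v ⊤ N (ρ / 8) := by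
    filter_upwards [hfloor, hend] with N hf he
    have chain : ENNReal.ofReal (c / 128 * N) ≤ coreOcc v ⊤ N (ρ / 8) + ENNReal.ofReal (c / 256 * N) :=
      hf.trans he
    rw [ofReal_split_two c hc N] at chain
    exact (ENNReal.add_le_add_iff_right ENNReal.ofReal_ne_top).1 chain
  -- (D): the Dirichlet endpoint at density `8 · ρ/8 = ρ`
  have h8 : HasGroundStateBEC v (8 * (ρ / 8)) := hD v hv (ρ / 8) hρ' ⟨c / 256, by positivity, key⟩
  have e : (8 : ℝ) * (ρ / 8) = ρ := by ring
  exact e ▸ h8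

section Conclusions

variable
    (hG : ∀ v : ℝ → ℝ≥0∞, IsRepulsiveFiniteRange v → ∃ ρ₁ : ℝ, 0 < ρ₁ ∧ ∀ ρ' : ℝ, 0 < ρ' → ρ' < ρ₁ →
      ∀ᶠ N : ℕ in atTop,
        2 * periodicGroundStateEnergy v N (sideLength ρ' N) < kyFanTwo v N (sideLength ρ' N))
    (hE : ∀ v : ℝ → ℝ≥0∞, IsRepulsiveFiniteRange v → ∃ ρ₁ : ℝ, 0 < ρ₁ ∧ ∀ ρ' : ℝ, 0 < ρ' → ρ' < ρ₁ →
      ∀ ε : ℝ, 0 < ε → ∀ᶠ N : ℕ in atTop,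
        coreOcc v 0 N ρ' ≤ coreOcc v ⊤ N ρ' + ENNReal.ofReal (ε * N))
include hG hE

/-- **`BoundaryTransferWeak_of_endpoint`** — (G) and (E) imply the crux BY NAME, with (T) and (D) supplied by
the landed theorems `RimSqueeze.stub_torusCoreFloor` (p156370) and `RimSqueeze.stub_dirichletEndpoint`
(p155818). [folklore] -/
theorem BoundaryTransferWeak_of_endpoint :
    Summit.AtomisticToContinuum.BoseEinsteinCondensation.Theses.BECPeriodicReduction.BoundaryTransferWeak :=
  boundaryTransfer_of_endpoint hG RimSqueeze.stub_torusCoreFloor hE RimSqueeze.stub_dirichletEndpoint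

/-- The same, concluding the `BECInsertionCorrector` copy of the crux by name. [folklore] -/
theorem BoundaryTransferWeak_of_endpoint_insertionCorrector :
    Summit.AtomisticToContinuum.BoseEinsteinCondensation.Theses.BECInsertionCorrector.BoundaryTransferWeak :=
  boundaryTransfer_of_endpoint hG RimSqueeze.stub_torusCoreFloor hE RimSqueeze.stub_dirichletEndpoint

/-- The same, concluding the `BECGroundStateSOS` copy of the crux by name. [folklore] -/
theorem BoundaryTransferWeak_of_endpoint_groundStateSOS :
    Summit.AtomisticToContinuum.BoseEinsteinCondensation.Theses.BECGroundStateSOS.BoundaryTransferWeak :=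
  boundaryTransfer_of_endpoint hG RimSqueeze.stub_torusCoreFloor hE RimSqueeze.stub_dirichletEndpoint

end Conclusions

/-- **Registered reduction (one-line form): the crux is closed modulo (G) and (E).** The torus Ky Fan gap (G)
and the endpoint transfer (E) imply `Theses.BECPeriodicReduction.BoundaryTransferWeak` (the item's registered decl),
(T) and (D) being the landed `RimSqueeze.stub_torusCoreFloor` / `RimSqueeze.stub_dirichletEndpoint`. [folklore] -/
theorem boundaryTransferWeak_of_endpointTransfer : (∀ v : ℝ → ℝ≥0∞, IsRepulsiveFiniteRange v → ∃ ρ₁ : ℝ, 0 < ρ₁ ∧ ∀ ρ' : ℝ, 0 < ρ' → ρ' < ρ₁ → ∀ᶠ N : ℕ in atTop, 2 * periodicGroundStateEnergy v N (sideLength ρ' N) < kyFanTwo v N (sideLength ρ' N)) → (∀ v : ℝ → ℝ≥0∞, IsRepulsiveFiniteRange v → ∃ ρ₁ : ℝ, 0 < ρ₁ ∧ ∀ ρ' : ℝ, 0 < ρ' → ρ' < ρ₁ → ∀ ε : ℝ, 0 < ε → ∀ᶠ N : ℕ in atTop, coreOcc v 0 N ρ' ≤ coreOcc v ⊤ N ρ'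 + ENNReal.ofReal (ε * N)) → Theses.BECPeriodicReduction.BoundaryTransferWeak :=
  fun hG hE => BoundaryTransferWeak_of_endpoint hG hE

/-! ## (iii) Skeleton v3 factors through the endpoint composition -/

/-- **The v3 composition factors through (E).** From the five v3 stubs (G), (T), (M), (L), (D) the crux follows by
`boundaryTransfer_of_endpoint` applied to (E) := `stub_endpointTransfer_of_stubs (M) (L)`: the coupling path of the
line enters only through (E). (Same statement as `RimSqueeze.Line.boundaryTransfer_of_stubs` of the registered
skeleton; different proof term.) [folklore] -/
theorem boundaryTransfer_of_stubs_v3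
    (hG : ∀ v : ℝ → ℝ≥0∞, IsRepulsiveFiniteRange v → ∃ ρ₁ : ℝ, 0 < ρ₁ ∧ ∀ ρ' : ℝ, 0 < ρ' → ρ' < ρ₁ →
      ∀ᶠ N : ℕ in atTop,
        2 * periodicGroundStateEnergy v N (sideLength ρ' N) < kyFanTwo v N (sideLength ρ' N))
    (hT : ∀ v : ℝ → ℝ≥0∞, IsRepulsiveFiniteRange v → ∀ ρ' : ℝ, 0 < ρ' → ∀ c : ℝ, 0 < c → ∀ N : ℕ,
      2 * periodicGroundStateEnergy v N (sideLength ρ' N) < kyFanTwo v N (sideLength ρ' N) →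
      (∃ δ : ℝ≥0∞, 0 < δ ∧ ∀ Ψ : PeriodicTrialState N (sideLength ρ' N),
          periodicEnergy v Ψ ≤ periodicGroundStateEnergy v N (sideLength ρ' N) + δ →
            ENNReal.ofReal (c * N) ≤ condensateOccupation N (sideLength ρ' N) Ψ.ψ) →
      ENNReal.ofReal (c / 128 * N) ≤ coreOcc v 0 N ρ')
    (hM : ∀ v : ℝ → ℝ≥0∞, IsRepulsiveFiniteRange v → ∃ ρ₁ : ℝ, 0 < ρ₁ ∧ ∀ ρ' : ℝ, 0 < ρ' → ρ' < ρ₁ →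
      ∀ ε : ℝ, 0 < ε → ∀ᶠ N : ℕ in atTop, ∀ t : ℝ≥0,
        coreOcc v 0 N ρ' ≤ coreOcc v (t : ℝ≥0∞) N ρ' + ENNReal.ofReal (ε * N))
    (hL : ∀ v : ℝ → ℝ≥0∞, IsRepulsiveFiniteRange v → ∃ ρ₁ : ℝ, 0 < ρ₁ ∧ ∀ ρ' : ℝ, 0 < ρ' → ρ' < ρ₁ →
      ∀ᶠ N : ℕ in atTop, ∀ η : ℝ, 0 < η → ∃ t₀ : ℝ≥0, ∀ t : ℝ≥0, t₀ ≤ t →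
        coreOcc v (t : ℝ≥0∞) N ρ' ≤ coreOcc v ⊤ N ρ' + ENNReal.ofReal η)
    (hD : ∀ v : ℝ → ℝ≥0∞, IsRepulsiveFiniteRange v → ∀ ρ' : ℝ, 0 < ρ' →
      (∃ c : ℝ, 0 < c ∧ ∀ᶠ N : ℕ in atTop, ENNReal.ofReal (c * N) ≤ coreOcc v ⊤ N ρ') →
        HasGroundStateBEC v (8 * ρ')) :
    Summit.AtomisticToContinuum.BoseEinsteinCondensation.Theses.BECPeriodicReduction.BoundaryTransferWeak :=
  boundaryTransfer_of_endpoint hG hT (stub_endpointTransfer_of_stubs hM hL) hD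

end Summit.AtomisticToContinuum.BoseEinsteinCondensation.RimSqueeze.Endpoint

end
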